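import Summits.AtomisticToContinuum.FouriersLaw.Theses.HonestZwanzig
import Summits.AtomisticToContinuum.FouriersLaw.Theorems.CoherentDephasing.Negative.ScalingNormalForm

/-!
# `PositiveMemory` (crux stmt-AtomisticToContinuum-12694, route `HonestZwanzig`):
# amplitude-scaling covariance of the Schur gadget and the unit-temperature normal form
# (negative-side support, crux-disprover seat gen 2; `Cruxes/PositiveMemory/Disproof.lean` §5)

`PositiveMemory` claims: for `pinnedChain ω₂ lam β γ` (all `> 0`) and `T > 0` there are `k₀ > 0` and `R` such that for
all `N ≥ 2`, every bulk bond `b` and every limit `ρ = lim_{s↓0} schur_s(j_b, J)` one has `k₀ ≤ ρ` (objects `μ =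
gibbsMeasure N T`, `corr`, `lap`, `G`, `schur`, `J` of the route file, verbatim below).

The amplitude scaling `z ↦ a • z` (`a > 0`) conjugates the equal-temperature Langevin chain `pinnedChain ω₂ lam β γ` at
temperature `T` with `pinnedChain ω₂ (lam a²) (β a²) γ` at `T / a²` — for the CONSTRUCTED objects the crux is typed with
(`CoherentDephasing.Negative.ScalingNormalForm`: `solMap_smul`, `integral_gibbsMeasure_smul`). This file pushes the
conjugacy through every layer of the route's Schur gadget, sorry-free:

* `integral_transitionKernel_smul` — kernel conjugacy for every continuous observable;
* `corr_smul`, `lap_smul` — `corr / lap` of degree-two observables (`f(a • z) = a² f'(z)`) scale by `a⁴`, for EVERY real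
  Laplace variable (constants leave Bochner integrals unconditionally, junk values included);
* `siteEnergy_smul`, `totalCurrent_fun_smul` (+ `bondCurrent_smul` of the Barriers file) — the split site energies `e_x`,
  the bond currents `j_b` and `J = Σ j_b` are degree-two observables; `continuous_siteEnergy`, `continuous_totalCurrent_fun`;
* `matrix_inv_smul_of_ne_zero`, `schur_scale_abstract` — `G ↦ a⁴ G`, `G⁻¹ ↦ a⁻⁴ G⁻¹` (Mathlib's junk inverse of a singular
  matrix included), so the Schur complement scales by `a⁴` (pure `Fin N` algebra);
* `schur_bond_smul` — hence `schur^{lam,β}_{T,σ}(j_b, J) = a⁴ · schur^{lam a²,β a²}_{T/a²,σ}(j_b, J)` for every real `σ`,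
  every `N`, every bond: the route's `let`-tower verbatim on both sides;
* `floor_iff_of_eq_const_mul`, `slice_iff_smul` — the `T`-slice of the crux for `(lam, β)` with floor `k₀` is equivalent to
  the `T/a²`-slice for `(lam a², β a²)` with floor `k₀ / a⁴` (same `R`; limits at `0⁺` correspond one-to-one);
* `positiveMemory_iff_unit_temperature` — **normal form: `PositiveMemory` is its `T = 1` slice over all couplings**, with
  `k₀(ω₂, lam, β, γ, T) = T² · k₀(ω₂, lam T, β T, γ, 1)`.

Consequences (for provers AND disprovers; this file does NOT refute the crux). (i) WLOG `T = 1`: the temperature axis IS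
the coupling ray `(lam T, β T)`. (ii) The crux docstring's worry "low `T` makes `k₀(T) ∼ (lam T)⁻²`-scale delicate" is a
statement about the WEAK-COUPLING corner `(lam T, β T) → 0` of the unit-temperature problem, entered with the explicit
factor `T²`; `PositiveMemory` asks for no uniformity along the ray, so neither the weak-coupling corner
(`LowTemperatureWeakAnharmonicity`, phonon kinetic regime) nor the strong-coupling corner (`T → ∞`) is load-bearing — only
`N`-uniformity at ONE coupling point is. (iii) Every `T`-uniform or `T`-monotone strengthening of the crux is a growth
statement for the unit-temperature floor along coupling rays (e.g. "`k₀` independent of `T ≤ 1`" says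
`k₀(lam T, β T; 1) ≥ c · T⁻²`, the kinetic-theory divergence of the conductivity at weak anharmonicity) — such
strengthenings are what a disproof may target and what a prover must not use.
-/

noncomputable section

namespace Summit.AtomisticToContinuum.FouriersLaw.Theorems.PositiveMemory.Negative.ScalingNormalForm

open MeasureTheory Filter Topology Set
open scoped NNReal
open Literature.MathematicalPhysics.KineticTheory.HeatConduction
open Literature.Probability.Process
open Summit.AtomisticToContinuum.FouriersLaw.Theorems.CoherentDephasing.Negative.ScalingNormalForm
  (solMap_smul integral_gibbsMeasure_smul)
open Literature.Barriers.AtomisticToContinuum.HeatConduction (bondCurrent_smul)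

variable {ω₂ lam β γ : ℝ}

/-! ## §1 Kernel conjugacy for continuous observables -/

/-- **Kernel conjugacy under the amplitude scaling**, for every continuous observable `g`:
`(K^{lam,β;T}_t g)(a • x) = (K^{lam a²,β a²;T/a²}_t (g ∘ (a • ·)))(x)` (law of the pathwise flow,
`solMap_smul`). [folklore] -/
theorem integral_transitionKernel_smul (hω : 0 < ω₂) (hl : 0 ≤ lam) (hβ : 0 ≤ β) (hγ : 0 ≤ γ)
    {a : ℝ} (ha : 0 < a) (n : ℕ) (T : ℝ) (t : ℝ≥0) (x : PhaseSpace n) {g : PhaseSpace n → ℝ}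
    (hg : Continuous g) :
    ∫ y, g y ∂((pinnedChain ω₂ lam β γ).transitionKernel n T T t (a • x)) =
      ∫ y, g (a • y) ∂((pinnedChain ω₂ (lam * a ^ 2) (β * a ^ 2) γ).transitionKernel n
        (T / a ^ 2) (T / a ^ 2) t x) := by
  have hl' : 0 ≤ lam * a ^ 2 := by positivity
  have hβ' : 0 ≤ β * a ^ 2 := by positivity
  have hg2 : Continuous fun y : PhaseSpace n => g (a • y) := hg.comp (continuous_const_smul a)
  rw [pinnedChain_integral_transitionKernel hω hl hβ hγ n T T t (a • x) hg.aestronglyMeasurable,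
    pinnedChain_integral_transitionKernel hω hl' hβ' hγ n _ _ t x hg2.aestronglyMeasurable]
  refine integral_congr_ae (Eventually.of_forall fun w => ?_)
  simp only
  rw [solMap_smul hω hl hβ hγ ha]

/-! ## §2 Correlation and Laplace scaling for degree-two observables -/

/-- **Correlation scaling.** For observables homogeneous of degree two under the scaling
(`f(a • z) = a² f'(z)`, `g(a • z) = a² g'(z)`, `g` continuous) the equilibrium two-time covariance of
the route obeys `corr^{lam,β}_T(f,g)(t) = a⁴ · corr^{lam a²,β a²}_{T/a²}(f',g')(t)`. [folklore] -/
theorem corr_smul (hω : 0 < ω₂) (hl : 0 ≤ lam) (hβ : 0 ≤ β) (hγ : 0 ≤ γ) {a : ℝ} (ha : 0 < a)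
    (n : ℕ) (T t : ℝ) {f g f' g' : PhaseSpace n → ℝ}
    (hf : ∀ z, f (a • z) = a ^ 2 * f' z) (hg : ∀ z, g (a • z) = a ^ 2 * g' z) (hgc : Continuous g) :
    (∫ z, f z * (∫ y, g y ∂((pinnedChain ω₂ lam β γ).transitionKernel n T T t.toNNReal z))
        ∂((pinnedChain ω₂ lam β γ).gibbsMeasure n T)) -
      (∫ z, f z ∂((pinnedChain ω₂ lam β γ).gibbsMeasure n T)) *
        (∫ z, g z ∂((pinnedChain ω₂ lam β γ).gibbsMeasure n T)) =
    a ^ 4 * ((∫ z, f' z * (∫ y, g' y ∂((pinnedChain ω₂ (lam * a ^ 2) (β * a ^ 2) γ).transitionKernel n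
        (T / a ^ 2) (T / a ^ 2) t.toNNReal z))
        ∂((pinnedChain ω₂ (lam * a ^ 2) (β * a ^ 2) γ).gibbsMeasure n (T / a ^ 2))) -
      (∫ z, f' z ∂((pinnedChain ω₂ (lam * a ^ 2) (β * a ^ 2) γ).gibbsMeasure n (T / a ^ 2))) *
        (∫ z, g' z ∂((pinnedChain ω₂ (lam * a ^ 2) (β * a ^ 2) γ).gibbsMeasure n (T / a ^ 2)))) := by
  rw [integral_gibbsMeasure_smul ha.ne' n T (fun z => f z *
      ∫ y, g y ∂((pinnedChain ω₂ lam β γ).transitionKernel n T T t.toNNReal z)),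
    integral_gibbsMeasure_smul ha.ne' n T f, integral_gibbsMeasure_smul ha.ne' n T g]
  have hK : ∀ x : PhaseSpace n,
      ∫ y, g y ∂((pinnedChain ω₂ lam β γ).transitionKernel n T T t.toNNReal (a • x)) =
        a ^ 2 * ∫ y, g' y ∂((pinnedChain ω₂ (lam * a ^ 2) (β * a ^ 2) γ).transitionKernel n
          (T / a ^ 2) (T / a ^ 2) t.toNNReal x) := by
    intro x
    rw [integral_transitionKernel_smul hω hl hβ hγ ha n T _ x hgc, ← integral_const_mul]
    exact integral_congr_ae (Eventually.of_forall fun y => hg y)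
  simp only [hf, hg, hK]
  have h1 : (fun x : PhaseSpace n => a ^ 2 * f' x * (a ^ 2 *
      ∫ y, g' y ∂((pinnedChain ω₂ (lam * a ^ 2) (β * a ^ 2) γ).transitionKernel n
        (T / a ^ 2) (T / a ^ 2) t.toNNReal x))) =
      fun x => a ^ 4 * (f' x * ∫ y, g' y ∂((pinnedChain ω₂ (lam * a ^ 2) (β * a ^ 2) γ).transitionKernel n
        (T / a ^ 2) (T / a ^ 2) t.toNNReal x)) := by
    funext x; ring
  rw [h1, integral_const_mul, integral_const_mul, integral_const_mul]
  ring

/-- **Laplace scaling**: `lap^{lam,β}_{T,s}(f,g) = a⁴ · lap^{lam a²,β a²}_{T/a²,s}(f',g')` for the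
same observables, every real `s` (constants leave the set integral). [folklore] -/
theorem lap_smul (hω : 0 < ω₂) (hl : 0 ≤ lam) (hβ : 0 ≤ β) (hγ : 0 ≤ γ) {a : ℝ} (ha : 0 < a)
    (n : ℕ) (T s : ℝ) {f g f' g' : PhaseSpace n → ℝ}
    (hf : ∀ z, f (a • z) = a ^ 2 * f' z) (hg : ∀ z, g (a • z) = a ^ 2 * g' z) (hgc : Continuous g) :
    (∫ t in Set.Ioi (0 : ℝ), Real.exp (-(s * t)) *
      ((∫ z, f z * (∫ y, g y ∂((pinnedChain ω₂ lam β γ).transitionKernel n T T t.toNNReal z))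
        ∂((pinnedChain ω₂ lam β γ).gibbsMeasure n T)) -
      (∫ z, f z ∂((pinnedChain ω₂ lam β γ).gibbsMeasure n T)) *
        (∫ z, g z ∂((pinnedChain ω₂ lam β γ).gibbsMeasure n T)))) =
    a ^ 4 * ∫ t in Set.Ioi (0 : ℝ), Real.exp (-(s * t)) *
      ((∫ z, f' z * (∫ y, g' y ∂((pinnedChain ω₂ (lam * a ^ 2) (β * a ^ 2) γ).transitionKernel n
        (T / a ^ 2) (T / a ^ 2) t.toNNReal z))
        ∂((pinnedChain ω₂ (lam * a ^ 2) (β * a ^ 2) γ).gibbsMeasure n (T / a ^ 2))) -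
      (∫ z, f' z ∂((pinnedChain ω₂ (lam * a ^ 2) (β * a ^ 2) γ).gibbsMeasure n (T / a ^ 2))) *
        (∫ z, g' z ∂((pinnedChain ω₂ (lam * a ^ 2) (β * a ^ 2) γ).gibbsMeasure n (T / a ^ 2)))) := by
  rw [← integral_const_mul (a ^ 4)]
  refine setIntegral_congr_fun (measurableSet_Ioi : MeasurableSet (Set.Ioi (0 : ℝ))) fun t _ => ?_
  rw [corr_smul hω hl hβ hγ ha n T t hf hg hgc]
  ring

/-! ## §3 Homogeneity and continuity of the route's observables -/

/-- The symmetrically split site energy is homogeneous of degree two: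
`e^{lam,β}_x(a • z) = a² · e^{lam a²,β a²}_x(z)`. [folklore] -/
theorem siteEnergy_smul (a : ℝ) (N : ℕ) (x : Fin N) (z : PhaseSpace N) :
    ((a • z).2 x ^ 2 / 2 + (pinnedChain ω₂ lam β γ).U ((a • z).1 x) +
      ∑ j : Fin N, ((if j.val = x.val + 1 then (pinnedChain ω₂ lam β γ).V ((a • z).1 j - (a • z).1 x) / 2 else 0) +
        (if x.val = j.val + 1 then (pinnedChain ω₂ lam β γ).V ((a • z).1 x - (a • z).1 j) / 2 else 0))) =
    a ^ 2 * (z.2 x ^ 2 / 2 + (pinnedChain ω₂ (lam * a ^ 2) (β * a ^ 2) γ).U (z.1 x) +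
      ∑ j : Fin N, ((if j.val = x.val + 1 then (pinnedChain ω₂ (lam * a ^ 2) (β * a ^ 2) γ).V (z.1 j - z.1 x) / 2 else 0) +
        (if x.val = j.val + 1 then (pinnedChain ω₂ (lam * a ^ 2) (β * a ^ 2) γ).V (z.1 x - z.1 j) / 2 else 0))) := by
  simp only [pinnedChain, Prod.smul_fst, Prod.smul_snd, Pi.smul_apply, smul_eq_mul]
  rw [mul_add, mul_add, Finset.mul_sum]
  congr 1
  · ring
  · refine Finset.sum_congr rfl fun j _ => ?_
    split_ifs <;> ring

/-- The total current is homogeneous of degree two. [folklore] -/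
theorem totalCurrent_fun_smul (a : ℝ) (N : ℕ) (z : PhaseSpace N) :
    (∑ i : Fin N, (pinnedChain ω₂ lam β γ).bondCurrent N i (a • z)) =
      a ^ 2 * ∑ i : Fin N, (pinnedChain ω₂ (lam * a ^ 2) (β * a ^ 2) γ).bondCurrent N i z := by
  rw [Finset.mul_sum]
  exact Finset.sum_congr rfl fun i _ => bondCurrent_smul ω₂ lam β γ a i z

/-- The site energies are continuous (polynomials in the coordinates). [folklore] -/
theorem continuous_siteEnergy (N : ℕ) (x : Fin N) :
    Continuous fun z : PhaseSpace N => z.2 x ^ 2 / 2 + (pinnedChain ω₂ lam β γ).U (z.1 x) +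
      ∑ j : Fin N, ((if j.val = x.val + 1 then (pinnedChain ω₂ lam β γ).V (z.1 j - z.1 x) / 2 else 0) +
        (if x.val = j.val + 1 then (pinnedChain ω₂ lam β γ).V (z.1 x - z.1 j) / 2 else 0)) := by
  simp only [pinnedChain]
  refine ((Continuous.add (by fun_prop) (by fun_prop)).add (continuous_finsetSum _ fun j _ => ?_))
  refine Continuous.add ?_ ?_ <;> split_ifs <;> fun_prop

/-- The total current is continuous. [folklore] -/
theorem continuous_totalCurrent_fun (N : ℕ) :
    Continuous fun z : PhaseSpace N => ∑ i : Fin N, (pinnedChain ω₂ lam β γ).bondCurrent N i z :=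
  continuous_finsetSum _ fun i _ => pinnedChain_continuous_bondCurrent ω₂ lam β γ N i

/-! ## §4 The abstract Schur rescaling (pure `Fin N` algebra) -/

/-- Inverse of a scalar multiple of a square matrix over a field, with Mathlib's junk convention
(`A⁻¹ = 0` for singular `A`) on both sides: `(c • A)⁻¹ = c⁻¹ • A⁻¹` for `c ≠ 0`. [folklore] -/
theorem matrix_inv_smul_of_ne_zero {N : ℕ} {c : ℝ} (hc : c ≠ 0) (A : Matrix (Fin N) (Fin N) ℝ) :
    (c • A)⁻¹ = c⁻¹ • A⁻¹ := by
  by_cases hA : IsUnit A.det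
  · refine Matrix.inv_eq_left_inv ?_
    rw [Matrix.smul_mul, Matrix.mul_smul, Matrix.nonsing_inv_mul A hA, smul_smul, inv_mul_cancel₀ hc,
      one_smul]
  · have hcA : ¬ IsUnit (c • A).det := by
      rw [Matrix.det_smul, isUnit_iff_ne_zero, Fintype.card_fin]
      rw [isUnit_iff_ne_zero, not_not] at hA
      simp [hA]
    rw [Matrix.nonsing_inv_apply_not_isUnit _ hcA, Matrix.nonsing_inv_apply_not_isUnit _ hA, smul_zero]

/-- **Abstract Schur rescaling.** If two pairings `lap, lap'` agree up to the factor `c ≠ 0` on the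
four families of pairs entering the Schur complement, the Schur complements agree up to `c`. -/
theorem schur_scale_abstract {X : Type*} {N : ℕ} {c : ℝ} (hc : c ≠ 0)
    (lap lap' : (X → ℝ) → (X → ℝ) → ℝ) (e e' : Fin N → X → ℝ) (f f' g g' : X → ℝ)
    (hee : ∀ x y, lap (e x) (e y) = c * lap' (e' x) (e' y))
    (hfe : ∀ x, lap f (e x) = c * lap' f' (e' x))
    (heg : ∀ y, lap (e y) g = c * lap' (e' y) g')
    (hfg : lap f g = c * lap' f' g') :
    lap f g - ∑ x, ∑ y, lap f (e x) * (Matrix.of fun x y => lap (e x) (e y))⁻¹ x y * lap (e y) g =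
      c * (lap' f' g' - ∑ x, ∑ y, lap' f' (e' x) *
        (Matrix.of fun x y => lap' (e' x) (e' y))⁻¹ x y * lap' (e' y) g') := by
  have hG : (Matrix.of fun x y => lap (e x) (e y)) = c • Matrix.of fun x y => lap' (e' x) (e' y) := by
    ext x y
    simp [hee]
  rw [hG, matrix_inv_smul_of_ne_zero hc, hfg, mul_sub, Finset.mul_sum]
  congr 1
  refine Finset.sum_congr rfl fun x _ => ?_
  rw [Finset.mul_sum]
  refine Finset.sum_congr rfl fun y _ => ?_
  rw [hfe, heg, Matrix.smul_apply, smul_eq_mul]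
  field_simp


/-! ## §5 Schur scaling of the bond responses, slice transfer, unit-temperature normal form -/

/-- Transfer of the floor clause along `u = c · v` (`c > 0`): "every limit of `u` at `0⁺` is `≥ k`" iff
"every limit of `v` at `0⁺` is `≥ k / c`". [folklore] -/
theorem floor_iff_of_eq_const_mul {u v : ℝ → ℝ} {c : ℝ} (hc : 0 < c) (k : ℝ) (h : ∀ σ, u σ = c * v σ) :
    (∀ ρ : ℝ, Filter.Tendsto u (nhdsWithin (0 : ℝ) (Set.Ioi 0)) (nhds ρ) → k ≤ ρ) ↔
      (∀ ρ : ℝ, Filter.Tendsto v (nhdsWithin (0 : ℝ) (Set.Ioi 0)) (nhds ρ) → k / c ≤ ρ) := by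
  constructor
  · intro hu ρ hv
    have h1 : Tendsto u (nhdsWithin (0 : ℝ) (Set.Ioi 0)) (nhds (c * ρ)) :=
      (hv.const_mul c).congr fun σ => (h σ).symm
    have h2 := hu _ h1
    rwa [div_le_iff₀ hc, mul_comm]
  · intro hv ρ hu
    have h1 : Tendsto v (nhdsWithin (0 : ℝ) (Set.Ioi 0)) (nhds (c⁻¹ * ρ)) := by
      refine (hu.const_mul c⁻¹).congr fun σ => ?_
      rw [h σ, ← mul_assoc, inv_mul_cancel₀ hc.ne', one_mul]
    have h2 := hv _ h1
    rw [div_le_iff₀ hc] at h2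
    calc k ≤ c⁻¹ * ρ * c := h2
      _ = ρ := by field_simp

/-- **Schur scaling of the bond responses** (the route's gadget, verbatim): for every real `σ` and
every bond `b`, `schur^{lam,β}_{T,σ}(j_b, J) = a⁴ · schur^{lam a²,β a²}_{T/a²,σ}(j_b, J)` (`a > 0`). All
`corr / lap` pairs entering the Schur complement are covariances of degree-two observables, `G` scales
by `a⁴` and `G⁻¹` by `a⁻⁴` (Mathlib's junk inverse included), so the identity is unconditional in `σ`.
[folklore] -/
theorem schur_bond_smul (hω : 0 < ω₂) (hl : 0 ≤ lam) (hβ : 0 ≤ β) (hγ : 0 ≤ γ) {a : ℝ} (ha : 0 < a)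
    (N : ℕ) (T σ : ℝ) (b : Fin N) :
    (let P := Literature.MathematicalPhysics.KineticTheory.HeatConduction.pinnedChain ω₂ lam β γ; let X := Literature.MathematicalPhysics.KineticTheory.HeatConduction.PhaseSpace N; let μ : MeasureTheory.Measure X := P.gibbsMeasure N T; let corr : (X → ℝ) → (X → ℝ) → ℝ → ℝ := fun f g t => (∫ z, f z * (∫ y, g y ∂(P.transitionKernel N T T t.toNNReal z)) ∂μ) - (∫ z, f z ∂μ) * (∫ z, g z ∂μ); let lap : ℝ → (X → ℝ) → (X → ℝ) → ℝ := fun s f g => ∫ t in Set.Ioi (0 : ℝ), Real.exp (-(s * t)) * corr f g t; let e : Fin N → X → ℝ := fun x z => z.2 x ^ 2 / 2 + P.U (z.1 x) + ∑ j : Fin N, ((if j.val = x.val + 1 then P.V (z.1 j - z.1 x) / 2 else 0) + (if x.val = j.val + 1 then P.V (z.1 x - z.1 j) / 2 else 0)); let G : ℝ → Matrix (Fin N) (Fin N) ℝ := fun s => Matrix.of fun x y => lap s (e x) (e y); let schur : ℝ → (X → ℝ) → (X → ℝ) → ℝ := fun s f g => lap s f g - ∑ x : Fin N, ∑ y : Fin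 N, lap s f (e x) * (G s)⁻¹ x y * lap s (e y) g; let J : X → ℝ := fun z => ∑ i : Fin N, P.bondCurrent N i z; schur σ (P.bondCurrent N b) J) =
      a ^ 4 * (let P := Literature.MathematicalPhysics.KineticTheory.HeatConduction.pinnedChain ω₂ (lam * a ^ 2) (β * a ^ 2) γ; let X := Literature.MathematicalPhysics.KineticTheory.HeatConduction.PhaseSpace N; let μ : MeasureTheory.Measure X := P.gibbsMeasure N (T / a ^ 2); let corr : (X → ℝ) → (X → ℝ) → ℝ → ℝ := fun f g t => (∫ z, f z * (∫ y, g y ∂(P.transitionKernel N (T / a ^ 2) (T / a ^ 2) t.toNNReal z)) ∂μ) - (∫ z, f z ∂μ) * (∫ z, g z ∂μ); let lap : ℝ → (X → ℝ) → (X → ℝ) → ℝ := fun s f g => ∫ t in Set.Ioi (0 : ℝ), Real.exp (-(s * t)) * corr f g t; let e : Fin N → X → ℝ := fun x z => z.2 x ^ 2 / 2 + P.U (z.1 x) + ∑ j : Fin N, ((if j.val = x.val + 1 then P.V (z.1 j - z.1 x) / 2 else 0) + (if x.val = j.val + 1 then P.V (z.1 x - z.1 j) / 2 else 0)); let G : ℝ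 → Matrix (Fin N) (Fin N) ℝ := fun s => Matrix.of fun x y => lap s (e x) (e y); let schur : ℝ → (X → ℝ) → (X → ℝ) → ℝ := fun s f g => lap s f g - ∑ x : Fin N, ∑ y : Fin N, lap s f (e x) * (G s)⁻¹ x y * lap s (e y) g; let J : X → ℝ := fun z => ∑ i : Fin N, P.bondCurrent N i z; schur σ (P.bondCurrent N b) J) := by
  dsimp only
  have hl' : 0 ≤ lam * a ^ 2 := by positivity
  have hβ' : 0 ≤ β * a ^ 2 := by positivity
  have ha4 : (a ^ 4 : ℝ) ≠ 0 := by positivity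
  have hE := fun (x : Fin N) (z : Literature.MathematicalPhysics.KineticTheory.HeatConduction.PhaseSpace N) =>
    siteEnergy_smul (ω₂ := ω₂) (lam := lam) (β := β) (γ := γ) a N x z
  have hJ := fun (z : Literature.MathematicalPhysics.KineticTheory.HeatConduction.PhaseSpace N) =>
    totalCurrent_fun_smul (ω₂ := ω₂) (lam := lam) (β := β) (γ := γ) a N z
  have hj := fun (z : Literature.MathematicalPhysics.KineticTheory.HeatConduction.PhaseSpace N) =>
    bondCurrent_smul ω₂ lam β γ a b z
  exact schur_scale_abstract ha4 (fun f g => ∫ t in Set.Ioi (0 : ℝ), Real.exp (-(σ * t)) * ((∫ z, f z * (∫ y, g y ∂((Literature.MathematicalPhysics.KineticTheory.HeatConduction.pinnedChain ω₂ lam β γ).transitionKernel N T T t.toNNReal z)) ∂((Literature.MathematicalPhysics.KineticTheory.HeatConduction.pinnedChain ω₂ lam β γ).gibbsMeasure N T)) - (∫ z, f z ∂((Literature.MathematicalPhysics.KineticTheory.HeatConduction.pinnedChain ω₂ lam β γ).gibbsMeasure N T)) * (∫ z, g z ∂((Literature.MathematicalPhysics.KineticTheory.HeatConduction.pinnedChain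 ω₂ lam β γ).gibbsMeasure N T)))) (fun f g => ∫ t in Set.Ioi (0 : ℝ), Real.exp (-(σ * t)) * ((∫ z, f z * (∫ y, g y ∂((Literature.MathematicalPhysics.KineticTheory.HeatConduction.pinnedChain ω₂ (lam * a ^ 2) (β * a ^ 2) γ).transitionKernel N (T / a ^ 2) (T / a ^ 2) t.toNNReal z)) ∂((Literature.MathematicalPhysics.KineticTheory.HeatConduction.pinnedChain ω₂ (lam * a ^ 2) (β * a ^ 2) γ).gibbsMeasure N (T / a ^ 2))) - (∫ z, f z ∂((Literature.MathematicalPhysics.KineticTheory.HeatConduction.pinnedChain ω₂ (lam * a ^ 2) (β * a ^ 2) γ).gibbsMeasure N (T / a ^ 2))) * (∫ z, g z ∂((Literature.MathematicalPhysics.KineticTheory.HeatConduction.pinnedChain ω₂ (lam * a ^ 2) (β * a ^ 2) γ).gibbsMeasure N (T / a ^ 2))))) (fun (x : Fin N) (z : Literature.MathematicalPhysics.KineticTheory.HeatConduction.PhaseSpace N) => z.2 x ^ 2 / 2 + (Literature.MathematicalPhysics.KineticTheory.HeatConduction.pinnedChain ω₂ lam β γ).U (z.1 x) + ∑ j : Fin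 N, ((if j.val = x.val + 1 then (Literature.MathematicalPhysics.KineticTheory.HeatConduction.pinnedChain ω₂ lam β γ).V (z.1 j - z.1 x) / 2 else 0) + (if x.val = j.val + 1 then (Literature.MathematicalPhysics.KineticTheory.HeatConduction.pinnedChain ω₂ lam β γ).V (z.1 x - z.1 j) / 2 else 0))) (fun (x : Fin N) (z : Literature.MathematicalPhysics.KineticTheory.HeatConduction.PhaseSpace N) => z.2 x ^ 2 / 2 + (Literature.MathematicalPhysics.KineticTheory.HeatConduction.pinnedChain ω₂ (lam * a ^ 2) (β * a ^ 2) γ).U (z.1 x) + ∑ j : Fin N, ((if j.val = x.val + 1 then (Literature.MathematicalPhysics.KineticTheory.HeatConduction.pinnedChain ω₂ (lam * a ^ 2) (β * a ^ 2) γ).V (z.1 j - z.1 x) / 2 else 0) + (if x.val = j.val + 1 then (Literature.MathematicalPhysics.KineticTheory.HeatConduction.pinnedChain ω₂ (lam * a ^ 2) (β * a ^ 2) γ).V (z.1 x - z.1 j) / 2 else 0))) ((Literature.MathematicalPhysics.KineticTheory.HeatConduction.pinnedChain ω₂ lam β γ).bondCurrent N b) ((Literature.MathematicalPhysics.KineticTheory.HeatConduction.pinnedChain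 ω₂ (lam * a ^ 2) (β * a ^ 2) γ).bondCurrent N b) (fun z : Literature.MathematicalPhysics.KineticTheory.HeatConduction.PhaseSpace N => ∑ i : Fin N, (Literature.MathematicalPhysics.KineticTheory.HeatConduction.pinnedChain ω₂ lam β γ).bondCurrent N i z) (fun z : Literature.MathematicalPhysics.KineticTheory.HeatConduction.PhaseSpace N => ∑ i : Fin N, (Literature.MathematicalPhysics.KineticTheory.HeatConduction.pinnedChain ω₂ (lam * a ^ 2) (β * a ^ 2) γ).bondCurrent N i z)
    (fun x y => lap_smul hω hl hβ hγ ha N T σ (hE x) (hE y) (continuous_siteEnergy N y))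
    (fun x => lap_smul hω hl hβ hγ ha N T σ hj (hE x) (continuous_siteEnergy N x))
    (fun y => lap_smul hω hl hβ hγ ha N T σ (hE y) hJ (continuous_totalCurrent_fun N))
    (lap_smul hω hl hβ hγ ha N T σ hj hJ (continuous_totalCurrent_fun N))

/-- **Slice transfer.** The `T`-slice of `PositiveMemory` for `pinnedChain ω₂ lam β γ` holds iff the
`T/a²`-slice holds for `pinnedChain ω₂ (lam a²) (β a²) γ` (`a > 0`; floors `k₀ ↔ k₀ / a⁴`, same `R`).
[folklore] -/
theorem slice_iff_smul (hω : 0 < ω₂) (hl : 0 ≤ lam) (hβ : 0 ≤ β) (hγ : 0 ≤ γ) {a : ℝ} (ha : 0 < a)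
    (T : ℝ) :
    (∃ k₀ : ℝ, 0 < k₀ ∧ ∃ R : ℕ, ∀ N : ℕ, 2 ≤ N → let P := Literature.MathematicalPhysics.KineticTheory.HeatConduction.pinnedChain ω₂ lam β γ; let X := Literature.MathematicalPhysics.KineticTheory.HeatConduction.PhaseSpace N; let μ : MeasureTheory.Measure X := P.gibbsMeasure N T; let corr : (X → ℝ) → (X → ℝ) → ℝ → ℝ := fun f g t => (∫ z, f z * (∫ y, g y ∂(P.transitionKernel N T T t.toNNReal z)) ∂μ) - (∫ z, f z ∂μ) * (∫ z, g z ∂μ); let lap : ℝ → (X → ℝ) → (X → ℝ) → ℝ := fun s f g => ∫ t in Set.Ioi (0 : ℝ), Real.exp (-(s * t)) * corr f g t; let e : Fin N → X → ℝ := fun x z => z.2 x ^ 2 / 2 + P.U (z.1 x) + ∑ j : Fin N, ((if j.val = x.val + 1 then P.V (z.1 j - z.1 x) / 2 else 0) + (if x.val = j.val + 1 then P.V (z.1 x - z.1 j) / 2 else 0)); let G : ℝ → Matrix (Fin N) (Fin N) ℝ := fun s => Matrix.of fun x y => lap s (e x) (e y); let schur : ℝ → (X → ℝ) → (X → ℝ)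 → ℝ := fun s f g => lap s f g - ∑ x : Fin N, ∑ y : Fin N, lap s f (e x) * (G s)⁻¹ x y * lap s (e y) g; let J : X → ℝ := fun z => ∑ i : Fin N, P.bondCurrent N i z; ∀ b : Fin N, R ≤ b.val → b.val + 2 + R ≤ N → ∀ ρ : ℝ, Filter.Tendsto (fun s => schur s (P.bondCurrent N b) J) (nhdsWithin (0 : ℝ) (Set.Ioi 0)) (nhds ρ) → k₀ ≤ ρ) ↔
      (∃ k₀ : ℝ, 0 < k₀ ∧ ∃ R : ℕ, ∀ N : ℕ, 2 ≤ N → let P := Literature.MathematicalPhysics.KineticTheory.HeatConduction.pinnedChain ω₂ (lam * a ^ 2) (β * a ^ 2) γ; let X := Literature.MathematicalPhysics.KineticTheory.HeatConduction.PhaseSpace N; let μ : MeasureTheory.Measure X := P.gibbsMeasure N (T / a ^ 2); let corr : (X → ℝ) → (X → ℝ) → ℝ → ℝ := fun f g t => (∫ z, f z * (∫ y, g y ∂(P.transitionKernel N (T / a ^ 2) (T / a ^ 2) t.toNNReal z)) ∂μ) - (∫ z, f z ∂μ) * (∫ z, g z ∂μ); let lap : ℝ → (X → ℝ) → (X → ℝ)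 → ℝ := fun s f g => ∫ t in Set.Ioi (0 : ℝ), Real.exp (-(s * t)) * corr f g t; let e : Fin N → X → ℝ := fun x z => z.2 x ^ 2 / 2 + P.U (z.1 x) + ∑ j : Fin N, ((if j.val = x.val + 1 then P.V (z.1 j - z.1 x) / 2 else 0) + (if x.val = j.val + 1 then P.V (z.1 x - z.1 j) / 2 else 0)); let G : ℝ → Matrix (Fin N) (Fin N) ℝ := fun s => Matrix.of fun x y => lap s (e x) (e y); let schur : ℝ → (X → ℝ) → (X → ℝ) → ℝ := fun s f g => lap s f g - ∑ x : Fin N, ∑ y : Fin N, lap s f (e x) * (G s)⁻¹ x y * lap s (e y) g; let J : X → ℝ := fun z => ∑ i : Fin N, P.bondCurrent N i z; ∀ b : Fin N, R ≤ b.val → b.val + 2 + R ≤ N → ∀ ρ : ℝ, Filter.Tendsto (fun s => schur s (P.bondCurrent N b) J) (nhdsWithin (0 : ℝ) (Set.Ioi 0)) (nhds ρ) → k₀ ≤ ρ) := by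
  have ha4 : (0 : ℝ) < a ^ 4 := by positivity
  constructor
  · rintro ⟨k₀, hk₀, R, hR⟩
    refine ⟨k₀ / a ^ 4, div_pos hk₀ ha4, R, fun N hN => ?_⟩
    have key := hR N hN
    dsimp only at key ⊢
    intro b hRb hbN
    have hfun := fun σ => schur_bond_smul hω hl hβ hγ ha N T σ b
    dsimp only at hfun
    exact (floor_iff_of_eq_const_mul ha4 k₀ hfun).1 (key b hRb hbN)
  · rintro ⟨k₀, hk₀, R, hR⟩
    refine ⟨k₀ * a ^ 4, mul_pos hk₀ ha4, R, fun N hN => ?_⟩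
    have key := hR N hN
    dsimp only at key ⊢
    intro b hRb hbN
    have hfun := fun σ => schur_bond_smul hω hl hβ hγ ha N T σ b
    dsimp only at hfun
    refine (floor_iff_of_eq_const_mul ha4 (k₀ * a ^ 4) hfun).2 fun ρ hρ => ?_
    rw [mul_div_assoc, div_self ha4.ne', mul_one]
    exact key b hRb hbN ρ hρ

/-- **Normal form: `PositiveMemory` is its unit-temperature slice over all couplings.** By the exact
amplitude-scaling conjugacy `(lam, β, T) ≡ (lam T, β T, 1)` of the constructed kernels and Gibbs
measures, the quantifier `∀ T > 0` is redundant given `∀ lam, β > 0`, and the floors transform as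
`k₀(ω₂, lam, β, γ, T) = T² · k₀(ω₂, lam T, β T, γ, 1)` (same `R`). Consequences recorded in the module
docstring. [folklore] -/
theorem positiveMemory_iff_unit_temperature :
    Summit.AtomisticToContinuum.FouriersLaw.Theses.HonestZwanzig.PositiveMemory ↔
      ∀ ω₂ lam β γ : ℝ, 0 < ω₂ → 0 < lam → 0 < β → 0 < γ →
        ∃ k₀ : ℝ, 0 < k₀ ∧ ∃ R : ℕ, ∀ N : ℕ, 2 ≤ N → let P := Literature.MathematicalPhysics.KineticTheory.HeatConduction.pinnedChain ω₂ lam β γ; let X := Literature.MathematicalPhysics.KineticTheory.HeatConduction.PhaseSpace N; let μ : MeasureTheory.Measure X := P.gibbsMeasure N 1; let corr : (X → ℝ) → (X → ℝ) → ℝ → ℝ := fun f g t => (∫ z, f z * (∫ y, g y ∂(P.transitionKernel N 1 1 t.toNNReal z)) ∂μ) - (∫ z, f z ∂μ) * (∫ z, g z ∂μ); let lap : ℝ → (X → ℝ) → (X → ℝ) → ℝ := fun s f g => ∫ t in Set.Ioi (0 : ℝ), Real.exp (-(s * t)) * corr f g t; let e : Fin N → X → ℝ := fun x z => z.2 x ^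 2 / 2 + P.U (z.1 x) + ∑ j : Fin N, ((if j.val = x.val + 1 then P.V (z.1 j - z.1 x) / 2 else 0) + (if x.val = j.val + 1 then P.V (z.1 x - z.1 j) / 2 else 0)); let G : ℝ → Matrix (Fin N) (Fin N) ℝ := fun s => Matrix.of fun x y => lap s (e x) (e y); let schur : ℝ → (X → ℝ) → (X → ℝ) → ℝ := fun s f g => lap s f g - ∑ x : Fin N, ∑ y : Fin N, lap s f (e x) * (G s)⁻¹ x y * lap s (e y) g; let J : X → ℝ := fun z => ∑ i : Fin N, P.bondCurrent N i z; ∀ b : Fin N, R ≤ b.val → b.val + 2 + R ≤ N → ∀ ρ : ℝ, Filter.Tendsto (fun s => schur s (P.bondCurrent N b) J) (nhdsWithin (0 : ℝ) (Set.Ioi 0)) (nhds ρ) → k₀ ≤ ρ := by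
  refine ⟨fun h ω₂ lam β γ hω hl hβ hγ => h ω₂ lam β γ hω hl hβ hγ 1 one_pos, ?_⟩
  intro h ω₂ lam β γ hω hl hβ hγ T hT
  have hs : 0 < Real.sqrt T := Real.sqrt_pos.2 hT
  have key := slice_iff_smul hω hl.le hβ.le hγ.le hs T
  simp only [Real.sq_sqrt hT.le, div_self hT.ne'] at key
  exact key.2 (h ω₂ (lam * T) (β * T) γ hω (by positivity) (by positivity) hγ)

end Summit.AtomisticToContinuum.FouriersLaw.Theorems.PositiveMemory.Negative.ScalingNormalForm

end
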